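import Literature.MathematicalPhysics.KineticTheory.HardSphereCanonicalPairBound
import HarnessLib

/-!
# Ruelle-type upper bounds for few-particle events of the canonical hard-sphere gas on `𝕋³`

Topic `Literature/MathematicalPhysics/KineticTheory` (sequel of `HardSphereCanonicalPairBound`; rung-0 statics of the crux line
`even-rung-mean-variance` of `JParityClosure.EvenStressEnskog`, stmt-AtomisticToContinuum-13079: second moments of collision-tube
counts, three-body tube remainders, collision-flux bounds).

For `N + 1` hard spheres of diameter `ε_N = hsDiameter σ N` on the unit torus with uniform activity, an event `E` that only
involves the positions of the labels in a finite set `B` has canonical probability at most `2^{#B}` times its probability for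
INDEPENDENT uniform points, at small reduced density (`SmallDensity uniformProfile σ`):

* `pi_hardCore_inter_le_of_dependsOn` — dropping the hard-core constraints involving `B`:
  `ℙ^{⊗}(hardCore(univ) ∩ E) ≤ Ξ(univ ∖ B) · ℙ^{⊗}(E)`;
* `hcProb_sdiff_mul_inv_eq_rN`, `posGibbs_le_two_pow_mul_pi` — `Ξ(univ ∖ B)/Ξ(univ) = r_N(N+1, #B) ≤ 2^{#B}`
  (`SmallDensity.rN_le_two_pow`), hence `posGibbsMeasure 1 ε_N (N+1) E ≤ 2^{#B} · ℙ^{⊗}(E)`;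
* the independent probabilities of the basic three- and four-label events (translation invariance of Haar measure):
  `pi_tripleEvent_eq` — `ℙ^{⊗}{x_j − x_i ∈ T, x_k − x_i ∈ T'} = vol(T) vol(T')` (`i, j, k` distinct),
  `pi_quadEvent_eq` — `ℙ^{⊗}{x_j − x_i ∈ T, x_l − x_k ∈ T'} = vol(T) vol(T')` (`i, j, k, l` distinct);
* `posGibbs_tripleEvent_le` (`≤ 8 vol(T) vol(T')`) and `posGibbs_quadEvent_le` (`≤ 16 vol(T) vol(T')`).

These are the `m = 3, 4` cases of the Ruelle bound for the canonical correlation functions of a hard-core gas (Ruelle 1969 §4.2;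
Pulvirenti–Tsagkarogiannis 2012 §3), in the event form needed for second-moment computations at the contact scale.

## References
* D. Ruelle, *Statistical Mechanics: Rigorous Results* (1969), §4.2.  [Ruelle1969]
* E. Pulvirenti, D. Tsagkarogiannis, Comm. Math. Phys. 316 (2012) 289–306, §3.  [PulvirentiTsagkarogiannis2012]
-/

noncomputable section

namespace Literature.MathematicalPhysics.KineticTheory

open MeasureTheory ProbabilityTheory Finset Filter Set StatisticalMechanics
open scoped ENNReal

/-! ## Dropping the hard-core constraints of a set of labels -/

/-- The indicator of a set that only involves the labels in `B` depends only on `B`. [folklore] -/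
theorem dependsOn_indicator_of_mem_iff {n : ℕ} {B : Finset (Fin n)} {E : Set (Fin n → T3)}
    (hdep : ∀ x y : Fin n → T3, (∀ b ∈ B, x b = y b) → (x ∈ E ↔ y ∈ E)) :
    DependsOn (fun x : Fin n → T3 => E.indicator (1 : (Fin n → T3) → ℝ) x) (B : Set (Fin n)) := by
  intro x y hxy
  change E.indicator (1 : (Fin n → T3) → ℝ) x = E.indicator (1 : (Fin n → T3) → ℝ) y
  have hiff := hdep x y fun b hb => hxy b hb
  by_cases hx : x ∈ E
  · rw [Set.indicator_of_mem hx, Set.indicator_of_mem (hiff.1 hx)]; rfl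
  · rw [Set.indicator_of_notMem hx, Set.indicator_of_notMem (fun hy => hx (hiff.2 hy))]

/-- **Dropping constraints**: for an event `E` involving only the labels in `B`,
`ℙ^{⊗}(hardCore(univ) ∩ E) ≤ Ξ(univ ∖ B) · ℙ^{⊗}(E)`. [folklore] -/
theorem pi_hardCore_inter_le_of_dependsOn (ε : ℝ) {n : ℕ} (B : Finset (Fin n)) {E : Set (Fin n → T3)}
    (hE : MeasurableSet E) (hdep : ∀ x y : Fin n → T3, (∀ b ∈ B, x b = y b) → (x ∈ E ↔ y ∈ E)) :
    (Measure.pi fun _ : Fin n => (volume : Measure T3)) (hardCoreSet (Ov ε) (univ : Finset (Fin n)) ∩ E)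
      ≤ ENNReal.ofReal (hcProb (Ov ε) (volume : Measure T3) ((univ : Finset (Fin n)) \ B)) *
          (Measure.pi fun _ : Fin n => (volume : Measure T3)) E := by
  classical
  set W : Finset (Fin n) := (univ : Finset (Fin n)) \ B with hW
  set P : Measure (Fin n → T3) := Measure.pi fun _ : Fin n => (volume : Measure T3) with hP
  have hHC : MeasurableSet (hardCoreSet (Ov ε) W : Set (Fin n → T3)) :=
    measurableSet_hardCoreSet (measurableSet_ov ε) W
  have hsub : hardCoreSet (Ov ε) (univ : Finset (Fin n)) ∩ E ⊆ hardCoreSet (Ov ε) W ∩ E :=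
    Set.inter_subset_inter_left _ fun x hx a _ b _ hab => hx a (mem_univ a) b (mem_univ b) hab
  refine (measure_mono hsub).trans ?_
  have hdisj : Disjoint W B := sdiff_disjoint
  have hF : DependsOn (fun x : Fin n → T3 =>
      (hardCoreSet (Ov ε) W : Set (Fin n → T3)).indicator (1 : (Fin n → T3) → ℝ) x) (W : Set (Fin n)) := by
    refine dependsOn_indicator_of_mem_iff fun x y hxy => ?_
    simp only [hardCoreSet, Set.mem_setOf_eq]
    constructor
    · intro h a ha b hb hab; rw [← hxy a ha, ← hxy b hb]; exact h a ha b hb hab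
    · intro h a ha b hb hab; rw [hxy a ha, hxy b hb]; exact h a ha b hb hab
  have hG : DependsOn (fun x : Fin n → T3 => E.indicator (1 : (Fin n → T3) → ℝ) x) (B : Set (Fin n)) :=
    dependsOn_indicator_of_mem_iff hdep
  have hFm : Measurable fun x : Fin n → T3 =>
      (hardCoreSet (Ov ε) W : Set (Fin n → T3)).indicator (1 : (Fin n → T3) → ℝ) x :=
    measurable_one.indicator hHC
  have hGm : Measurable fun x : Fin n → T3 => E.indicator (1 : (Fin n → T3) → ℝ) x :=
    measurable_one.indicator hE
  have hprod := integral_mul_eq_of_dependsOn (volume : Measure T3) hdisj hFm hGm hF hG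
  have hinter : (hardCoreSet (Ov ε) W ∩ E).indicator (1 : (Fin n → T3) → ℝ)
      = fun x => (hardCoreSet (Ov ε) W : Set (Fin n → T3)).indicator 1 x * E.indicator 1 x := by
    rw [Set.inter_indicator_one]
    rfl
  have h1 : P.real (hardCoreSet (Ov ε) W ∩ E) = hcProb (Ov ε) (volume : Measure T3) W * P.real E := by
    rw [← integral_indicator_one (hHC.inter hE), hinter, hP, hprod, integral_indicator_one hHC,
      integral_indicator_one hE, hcProb]
  haveI : IsFiniteMeasure P := by rw [hP]; infer_instance
  rw [← ENNReal.ofReal_toReal (measure_ne_top P _), ← measureReal_def, h1,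
    ENNReal.ofReal_mul (hcProb_nonneg (volume : Measure T3) W), measureReal_def,
    ENNReal.ofReal_toReal (measure_ne_top _ _)]

/-- The ratio of hard-core probabilities is an inverse insertion probability:
`Ξ_N(univ ∖ B) / Ξ_N(univ) = r_N(N+1, #B)`. [folklore] -/
theorem hcProb_sdiff_mul_inv_eq_rN (σ : ℝ) {N : ℕ} (B : Finset (Fin (N + 1))) :
    hcProb (Ov (hsDiameter σ N)) (volume : Measure T3) ((univ : Finset (Fin (N + 1))) \ B) *
        (hcProb (Ov (hsDiameter σ N)) (volume : Measure T3) (univ : Finset (Fin (N + 1))))⁻¹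
      = rN uniformProfile σ N (N + 1) B.card := by
  classical
  have hBc : B.card ≤ N + 1 := by
    simpa using B.card_le_univ
  have hcard : ((univ : Finset (Fin (N + 1))) \ B).card = (firstLabels (N + 1) (N + 1 - B.card)).card := by
    rw [card_sdiff, Finset.inter_univ, card_univ, Fintype.card_fin, card_firstLabels (by omega)]
  have h1 : hcProb (Ov (hsDiameter σ N)) (volume : Measure T3) ((univ : Finset (Fin (N + 1))) \ B)
      = XiN uniformProfile σ N (N + 1 - B.card) := by
    rw [XiN, Xi, uniformProfile_μ]
    exact hcProb_eq_of_card_eq (volume : Measure T3) (measurableSet_ov _) hcard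
  have h2 : hcProb (Ov (hsDiameter σ N)) (volume : Measure T3) (univ : Finset (Fin (N + 1)))
      = XiN uniformProfile σ N (N + 1) := by
    rw [XiN, Xi, uniformProfile_μ, firstLabels_self]
  rw [h1, h2, rN, div_eq_mul_inv]

/-- **Ruelle-type bound**: at small density, an event involving only the labels in `B` has canonical probability at most
`2^{#B}` times its probability for independent uniform points. [folklore] -/
theorem posGibbs_le_two_pow_mul_pi {σ : ℝ} (h : SmallDensity uniformProfile σ) {N : ℕ} (B : Finset (Fin (N + 1)))
    {E : Set (Fin (N + 1) → T3)} (hE : MeasurableSet E)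
    (hdep : ∀ x y : Fin (N + 1) → T3, (∀ b ∈ B, x b = y b) → (x ∈ E ↔ y ∈ E)) :
    posGibbsMeasure (fun _ => (1 : ℝ)) (hsDiameter σ N) (N + 1) E
      ≤ (2 : ℝ≥0∞) ^ B.card * (Measure.pi fun _ : Fin (N + 1) => (volume : Measure T3)) E := by
  classical
  have hBc : B.card ≤ N + 1 := by simpa using B.card_le_univ
  rw [posGibbsMeasure_eq continuous_const (fun _ => one_pos) (hsDiameter σ N) (N + 1), Measure.smul_apply,
    smul_eq_mul, Measure.restrict_apply hE, profileOf_one_μ, Xi, firstLabels_self, profileOf_one_μ, Set.inter_comm]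
  calc ENNReal.ofReal (hcProb (Ov (hsDiameter σ N)) (volume : Measure T3) (univ : Finset (Fin (N + 1))))⁻¹ *
        (Measure.pi fun _ : Fin (N + 1) => (volume : Measure T3)) (hardCoreSet (Ov (hsDiameter σ N)) univ ∩ E)
      ≤ ENNReal.ofReal (hcProb (Ov (hsDiameter σ N)) (volume : Measure T3) (univ : Finset (Fin (N + 1))))⁻¹ *
          (ENNReal.ofReal (hcProb (Ov (hsDiameter σ N)) (volume : Measure T3) ((univ : Finset (Fin (N + 1))) \ B)) *
            (Measure.pi fun _ : Fin (N + 1) => (volume : Measure T3)) E) :=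
        mul_le_mul' le_rfl (pi_hardCore_inter_le_of_dependsOn _ B hE hdep)
    _ = ENNReal.ofReal (hcProb (Ov (hsDiameter σ N)) (volume : Measure T3) ((univ : Finset (Fin (N + 1))) \ B) *
          (hcProb (Ov (hsDiameter σ N)) (volume : Measure T3) (univ : Finset (Fin (N + 1))))⁻¹) *
          (Measure.pi fun _ : Fin (N + 1) => (volume : Measure T3)) E := by
        rw [ENNReal.ofReal_mul (hcProb_nonneg _ _), ← mul_assoc, mul_comm (ENNReal.ofReal _⁻¹)]
    _ ≤ (2 : ℝ≥0∞) ^ B.card * (Measure.pi fun _ : Fin (N + 1) => (volume : Measure T3)) E := by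
        refine mul_le_mul' ?_ le_rfl
        rw [hcProb_sdiff_mul_inv_eq_rN σ B]
        calc ENNReal.ofReal (rN uniformProfile σ N (N + 1) B.card)
            ≤ ENNReal.ofReal ((2 : ℝ) ^ B.card) := ENNReal.ofReal_le_ofReal (h.rN_le_two_pow le_rfl hBc)
          _ = (2 : ℝ≥0∞) ^ B.card := by
              rw [ENNReal.ofReal_pow (by norm_num : (0 : ℝ) ≤ 2), ENNReal.ofReal_ofNat]

/-! ## The independent probabilities of the basic three- and four-label events -/

/-- Integrating out the label `j ∉ {i} ∪ S`: for an event of the form `{x_j − x_i ∈ T} ∩ F` with `F` not involving `j`,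
`ℙ^{⊗}({x_j − x_i ∈ T} ∩ F) = vol(T) · ℙ^{⊗}(F)`. [folklore] -/
theorem pi_subEvent_inter_eq {n : ℕ} {i j : Fin n} (hij : i ≠ j) {T : Set T3} (hT : MeasurableSet T)
    {F : Set (Fin n → T3)} (hF : MeasurableSet F)
    (hFdep : ∀ (x : Fin n → T3) (y : T3), Function.update x j y ∈ F ↔ x ∈ F) :
    (Measure.pi fun _ : Fin n => (volume : Measure T3)) ({x | x j - x i ∈ T} ∩ F)
      = volume T * (Measure.pi fun _ : Fin n => (volume : Measure T3)) F := by
  classical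
  have hE : MeasurableSet {x : Fin n → T3 | x j - x i ∈ T} := measurableSet_pairEvent j i hT
  rw [← lintegral_indicator_one (hE.inter hF),
    lintegral_pi_eq_lintegral_update (volume : Measure T3) j (measurable_one.indicator (hE.inter hF))]
  have hinner : ∀ x : Fin n → T3,
      ∫⁻ y, ({x : Fin n → T3 | x j - x i ∈ T} ∩ F).indicator 1 (Function.update x j y) ∂(volume : Measure T3)
        = volume T * F.indicator 1 x := by
    intro x
    by_cases hx : x ∈ F
    · have hset : (fun y : T3 => ({x : Fin n → T3 | x j - x i ∈ T} ∩ F).indicator (1 : (Fin n → T3) → ℝ≥0∞)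
          (Function.update x j y)) = ((fun y : T3 => y - x i) ⁻¹' T).indicator 1 := by
        funext y
        have hy : Function.update x j y ∈ F := (hFdep x y).2 hx
        simp only [Set.indicator, Set.mem_inter_iff, Set.mem_setOf_eq, Set.mem_preimage, Function.update_self,
          Function.update_of_ne hij, Pi.one_apply, hy, and_true]
      rw [hset, lintegral_indicator_one (measurable_sub_const _ hT), Set.indicator_of_mem hx, Pi.one_apply, mul_one]
      have hfun : (fun y : T3 => y - x i) = fun y => y + -x i := by
        funext y; rw [sub_eq_add_neg]
      rw [hfun]
      exact measure_preimage_add_right _ _ _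
    · have hset : (fun y : T3 => ({x : Fin n → T3 | x j - x i ∈ T} ∩ F).indicator (1 : (Fin n → T3) → ℝ≥0∞)
          (Function.update x j y)) = fun _ => 0 := by
        funext y
        have hy : Function.update x j y ∉ F := fun h => hx ((hFdep x y).1 h)
        rw [Set.indicator_of_notMem (fun h => hy h.2)]
      rw [hset, lintegral_zero, Set.indicator_of_notMem hx, mul_zero]
  simp_rw [hinner]
  rw [lintegral_const_mul _ (measurable_one.indicator hF), lintegral_indicator_one hF]

/-- **Three labels**: `ℙ^{⊗}{x_j − x_i ∈ T, x_k − x_i ∈ T'} = vol(T) vol(T')` for distinct `i, j, k`. [folklore] -/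
theorem pi_tripleEvent_eq {n : ℕ} {i j k : Fin n} (hij : i ≠ j) (hik : i ≠ k) (hjk : j ≠ k)
    {T T' : Set T3} (hT : MeasurableSet T) (hT' : MeasurableSet T') :
    (Measure.pi fun _ : Fin n => (volume : Measure T3)) {x | x j - x i ∈ T ∧ x k - x i ∈ T'}
      = volume T * volume T' := by
  have hF : MeasurableSet {x : Fin n → T3 | x k - x i ∈ T'} := measurableSet_pairEvent k i hT'
  have hset : {x : Fin n → T3 | x j - x i ∈ T ∧ x k - x i ∈ T'} = {x | x j - x i ∈ T} ∩ {x | x k - x i ∈ T'} := rfl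
  rw [hset, pi_subEvent_inter_eq hij hT hF, pi_pairEvent_eq hik.symm hT']
  · intro x y
    simp only [Set.mem_setOf_eq, Function.update_of_ne hjk.symm, Function.update_of_ne hij]

/-- **Four labels**: `ℙ^{⊗}{x_j − x_i ∈ T, x_l − x_k ∈ T'} = vol(T) vol(T')` for distinct `i, j, k, l`. [folklore] -/
theorem pi_quadEvent_eq {n : ℕ} {i j k l : Fin n} (hij : i ≠ j) (hjk : j ≠ k) (hjl : j ≠ l) (hkl : k ≠ l)
    {T T' : Set T3} (hT : MeasurableSet T) (hT' : MeasurableSet T') :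
    (Measure.pi fun _ : Fin n => (volume : Measure T3)) {x | x j - x i ∈ T ∧ x l - x k ∈ T'}
      = volume T * volume T' := by
  have hF : MeasurableSet {x : Fin n → T3 | x l - x k ∈ T'} := measurableSet_pairEvent l k hT'
  have hset : {x : Fin n → T3 | x j - x i ∈ T ∧ x l - x k ∈ T'} = {x | x j - x i ∈ T} ∩ {x | x l - x k ∈ T'} := rfl
  rw [hset, pi_subEvent_inter_eq hij hT hF, pi_pairEvent_eq hkl.symm hT']
  · intro x y
    simp only [Set.mem_setOf_eq, Function.update_of_ne hjl.symm, Function.update_of_ne hjk.symm]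

/-! ## The canonical bounds for three- and four-label events -/

/-- **Three labels, canonical**: at small density, for `N ≥ 2`, distinct `i, j, k` and measurable `T, T'`,
`posGibbsMeasure 1 ε_N (N+1) {x_j − x_i ∈ T, x_k − x_i ∈ T'} ≤ 8 vol(T) vol(T')`. [folklore] -/
theorem posGibbs_tripleEvent_le {σ : ℝ} (h : SmallDensity uniformProfile σ) {N : ℕ} {i j k : Fin (N + 1)}
    (hij : i ≠ j) (hik : i ≠ k) (hjk : j ≠ k) {T T' : Set T3} (hT : MeasurableSet T) (hT' : MeasurableSet T') :
    posGibbsMeasure (fun _ => (1 : ℝ)) (hsDiameter σ N) (N + 1) {x | x j - x i ∈ T ∧ x k - x i ∈ T'}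
      ≤ 8 * (volume T * volume T') := by
  classical
  have hE : MeasurableSet {x : Fin (N + 1) → T3 | x j - x i ∈ T ∧ x k - x i ∈ T'} :=
    (measurableSet_pairEvent j i hT).inter (measurableSet_pairEvent k i hT')
  have hdep : ∀ x y : Fin (N + 1) → T3, (∀ b ∈ ({i, j, k} : Finset (Fin (N + 1))), x b = y b) →
      (x ∈ {x : Fin (N + 1) → T3 | x j - x i ∈ T ∧ x k - x i ∈ T'} ↔
        y ∈ {x : Fin (N + 1) → T3 | x j - x i ∈ T ∧ x k - x i ∈ T'}) := by
    intro x y hxy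
    simp only [Set.mem_setOf_eq, hxy i (by simp), hxy j (by simp), hxy k (by simp)]
  have hcard : ({i, j, k} : Finset (Fin (N + 1))).card = 3 := by
    rw [card_insert_of_notMem (by simp [hij, hik]), card_pair hjk]
  calc posGibbsMeasure (fun _ => (1 : ℝ)) (hsDiameter σ N) (N + 1) {x | x j - x i ∈ T ∧ x k - x i ∈ T'}
      ≤ (2 : ℝ≥0∞) ^ ({i, j, k} : Finset (Fin (N + 1))).card *
          (Measure.pi fun _ : Fin (N + 1) => (volume : Measure T3)) {x | x j - x i ∈ T ∧ x k - x i ∈ T'} :=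
        posGibbs_le_two_pow_mul_pi h _ hE hdep
    _ = 8 * (volume T * volume T') := by
        rw [hcard, pi_tripleEvent_eq hij hik hjk hT hT']
        norm_num

/-- **Four labels, canonical**: at small density, for distinct `i, j, k, l` and measurable `T, T'`,
`posGibbsMeasure 1 ε_N (N+1) {x_j − x_i ∈ T, x_l − x_k ∈ T'} ≤ 16 vol(T) vol(T')`. [folklore] -/
theorem posGibbs_quadEvent_le {σ : ℝ} (h : SmallDensity uniformProfile σ) {N : ℕ} {i j k l : Fin (N + 1)}
    (hij : i ≠ j) (hik : i ≠ k) (hil : i ≠ l) (hjk : j ≠ k) (hjl : j ≠ l) (hkl : k ≠ l)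
    {T T' : Set T3} (hT : MeasurableSet T) (hT' : MeasurableSet T') :
    posGibbsMeasure (fun _ => (1 : ℝ)) (hsDiameter σ N) (N + 1) {x | x j - x i ∈ T ∧ x l - x k ∈ T'}
      ≤ 16 * (volume T * volume T') := by
  classical
  have hE : MeasurableSet {x : Fin (N + 1) → T3 | x j - x i ∈ T ∧ x l - x k ∈ T'} :=
    (measurableSet_pairEvent j i hT).inter (measurableSet_pairEvent l k hT')
  have hdep : ∀ x y : Fin (N + 1) → T3, (∀ b ∈ ({i, j, k, l} : Finset (Fin (N + 1))), x b = y b) →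
      (x ∈ {x : Fin (N + 1) → T3 | x j - x i ∈ T ∧ x l - x k ∈ T'} ↔
        y ∈ {x : Fin (N + 1) → T3 | x j - x i ∈ T ∧ x l - x k ∈ T'}) := by
    intro x y hxy
    simp only [Set.mem_setOf_eq, hxy i (by simp), hxy j (by simp), hxy k (by simp), hxy l (by simp)]
  have hcard : ({i, j, k, l} : Finset (Fin (N + 1))).card = 4 := by
    rw [card_insert_of_notMem (by simp [hij, hik, hil]), card_insert_of_notMem (by simp [hjk, hjl]), card_pair hkl]
  calc posGibbsMeasure (fun _ => (1 : ℝ)) (hsDiameter σ N) (N + 1) {x | x j - x i ∈ T ∧ x l - x k ∈ T'}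
      ≤ (2 : ℝ≥0∞) ^ ({i, j, k, l} : Finset (Fin (N + 1))).card *
          (Measure.pi fun _ : Fin (N + 1) => (volume : Measure T3)) {x | x j - x i ∈ T ∧ x l - x k ∈ T'} :=
        posGibbs_le_two_pow_mul_pi h _ hE hdep
    _ = 16 * (volume T * volume T') := by
        rw [hcard, pi_quadEvent_eq hij hjk hjl hkl hT hT']
        norm_num

end Literature.MathematicalPhysics.KineticTheory

end
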